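import Literature.NumberTheory.ModularForms.InterpolationKernels
import Literature.NumberTheory.ModularForms.QAsymptotics3
import HarnessLib

/-!
# The bound (4.14) for `𝒦₊^{(24)}`: `𝒦₊^{(24)}(τ, z) = O(|τ| e^{−4π Im τ})` as `Im τ → ∞`

Cohn–Kumar–Miller–Radchenko–Viazovska, arXiv:1902.05438, §4.4 (4.14): "for fixed `z` and `τ → ∞`,
… `𝒦^{(24)}(τ,z), 𝒦±^{(24)}(τ,z) = O(|τ e^{4πiτ}|)`, so (4) holds."

PROVED here for `𝒦₊^{(24)}` and fixed `z` (`kernelPlus24_isBigO`), from the SECOND-order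
`q`-asymptotics (`QAsymptotics2.lean`). Writing `a = E₄(z)φ̃₋₂(z)`, `b = φ̃₂(z)`, `d = f₂(z)φ̃₀(z)`,
`J = j(τ) − j(z)`, `𝔠 = 1728`, off the poles
`𝒦₊^{(24)}·Δ(z)/c = a·𝒜 + b·𝓑 + d·𝒟` with
`𝒜 = 6φ₋₂E₁₄ − 12φ₀E₄³ + 5𝔠φ₀Δ + 6φ₂E₁₀ + 𝔠φ₂E₁₀J⁻¹`,
`𝓑 = −6φ₋₂E₁₄ + 12φ₀E₄³ − 7𝔠φ₀Δ − 6φ₂E₁₀ + 𝔠φ₋₂E₁₄J⁻¹`, `𝒟 = −2𝔠φ₀ΔJ⁻¹`,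
and each of `𝒜, 𝓑, 𝒟` is `O(|τ|q²)`: the orders `q⁰` and `q¹` cancel exactly, using
`E₁₄ = 1 − 24q + O(q²)`, `E₄³ = 1 + 720q + O(q²)`, `E₁₀ = 1 − 264q + O(q²)`, `Δ, J⁻¹ = q + O(q²)`,
`φ₋₂ − 2φ₀ + φ₂ = (144i/π)q + O(|τ|q²)`, `φ₂ − φ₋₂ = −6i/π + O(|τ|q)`.

## References

* H. Cohn, A. Kumar, S. D. Miller, D. Radchenko, M. Viazovska, Ann. of Math. 196 (2022),
  arXiv:1902.05438, Theorem 4.1 (4), §4.4 (4.14). [CohnEtAl2019]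
-/

noncomputable section

open Complex hiding I
open Filter Topology Asymptotics ModularForm SlashInvariantForm EisensteinSeries
open UpperHalfPlane hiding I
open Complex (I)
open scoped Real MatrixGroups ModularForm Manifold

namespace Literature.NumberTheory.ModularForms

open Literature.NumberTheory.EllipticCurves.ModularForms (kleinJ E₄_cube_eq_kleinJ_mul)

/-! ## Second-order ingredients -/

/-- `q = O(1)`. [folklore] -/
theorem qfun_isBigO_one : (fun τ => qfun τ) =O[atImInfty] fun _ : ℍ => (1 : ℝ) :=
  IsBigO.of_bound 1 (Eventually.of_forall fun τ => by simp [norm_qfun, expDecay_le_one τ])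

/-- **`E₁₄ − 1 + 24q`, `E₄³ − 1 − 720q`, `E₁₀ − 1 + 264q = O(q²)`.** [cite: CohnEtAl2019, §2.1.1 (2.1)] -/
theorem E14_E4cube_E10_second_order :
    ((fun τ : ℍ => E14fun τ - 1 + 24 * qfun τ) =O[atImInfty] fun τ => expDecay τ ^ 2) ∧
    ((fun τ : ℍ => E₄ τ ^ 3 - 1 - 720 * qfun τ) =O[atImInfty] fun τ => expDecay τ ^ 2) ∧
    ((fun τ : ℍ => E10fun τ - 1 + 264 * qfun τ) =O[atImInfty] fun τ => expDecay τ ^ 2) := by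
  have hX := E₄_sub_one_isBigO
  have hY := E₆_sub_one_isBigO
  have hX2 := E₄_second_order
  have hY2 := E₆_second_order
  have hX1 : (fun τ : ℍ => E₄ τ - 1) =O[atImInfty] fun _ : ℍ => (1 : ℝ) := hX.trans expDecay_isBigO_one'
  have hY1 : (fun τ : ℍ => E₆ τ - 1) =O[atImInfty] fun _ : ℍ => (1 : ℝ) := hY.trans expDecay_isBigO_one'
  have hXX : (fun τ : ℍ => (E₄ τ - 1) * (E₄ τ - 1)) =O[atImInfty] fun τ => expDecay τ ^ 2 := by simpa [sq] using hX.mul hX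
  have hXY : (fun τ : ℍ => (E₄ τ - 1) * (E₆ τ - 1)) =O[atImInfty] fun τ => expDecay τ ^ 2 := by simpa [sq] using hX.mul hY
  have hXXY : (fun τ : ℍ => (E₄ τ - 1) * (E₄ τ - 1) * (E₆ τ - 1)) =O[atImInfty] fun τ => expDecay τ ^ 2 := by
    simpa [mul_assoc] using hX1.mul hXY
  have hXXX : (fun τ : ℍ => (E₄ τ - 1) * ((E₄ τ - 1) * (E₄ τ - 1))) =O[atImInfty] fun τ => expDecay τ ^ 2 := by
    simpa using hX1.mul hXX
  refine ⟨?_, ?_, ?_⟩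
  · -- `E₄²E₆ − 1 + 24q = 2(x − 240q) + (y + 504q) + x² + 2xy + x²y`
    have := ((((hX2.const_mul_left 2).add hY2).add hXX).add (hXY.const_mul_left 2)).add hXXY
    exact this.congr_left fun τ => by simp only [E14fun, Pi.mul_apply]; ring
  · -- `E₄³ − 1 − 720q = 3(x − 240q) + 3x² + x³`
    have := ((hX2.const_mul_left 3).add (hXX.const_mul_left 3)).add hXXX
    exact this.congr_left fun τ => by ring
  · -- `E₄E₆ − 1 + 264q = (x − 240q) + (y + 504q) + xy`
    have := (hX2.add hY2).add hXY
    exact this.congr_left fun τ => by simp only [E10fun, Pi.mul_apply]; ring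

/-- **`(j(τ) − j(z))⁻¹ − q = O(q²)`**: `J⁻¹ = Δ/(E₄³ − j(z)Δ)` and
`Δ − q(E₄³ − j(z)Δ) = (Δ − q) − q(E₄³ − 1) + j(z)qΔ = O(q²)`. [cite: CohnEtAl2019, §2.1.1 (2.1)] -/
theorem inv_kleinJ_sub_sub_q_isBigO (z : ℍ) :
    (fun τ => (kleinJ τ - kleinJ z)⁻¹ - qfun τ) =O[atImInfty] fun τ => expDecay τ ^ 2 := by
  have hE4 : Tendsto (⇑E₄) atImInfty (𝓝 1) := ModularForm.tendsto_E_atImInfty (by norm_num) ⟨2, rfl⟩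
  have hΔ0 : Tendsto (ModularForm.discriminant : ℍ → ℂ) atImInfty (𝓝 0) := CuspFormClass.zero_at_infty CuspForm.discriminant
  have hden : Tendsto (fun τ => E₄ τ ^ 3 - kleinJ z * ModularForm.discriminant τ) atImInfty (𝓝 1) := by
    have := (hE4.pow 3).sub (hΔ0.const_mul (kleinJ z))
    simpa using this
  have hev : ∀ᶠ τ : ℍ in atImInfty, 1 / 2 ≤ ‖E₄ τ ^ 3 - kleinJ z * ModularForm.discriminant τ‖ := by
    have := (continuous_norm.tendsto (1 : ℂ)).comp hden
    rw [norm_one] at this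
    exact this.eventually (eventually_ge_nhds (by norm_num : (1 / 2 : ℝ) < 1))
  have hnum : (fun τ => (ModularForm.discriminant τ - qfun τ) - qfun τ * (E₄ τ ^ 3 - 1) +
      kleinJ z * (qfun τ * ModularForm.discriminant τ)) =O[atImInfty] fun τ => expDecay τ ^ 2 := by
    have h1 := discriminant_second_order
    have h2 : (fun τ => qfun τ * (E₄ τ ^ 3 - 1)) =O[atImInfty] fun τ => expDecay τ ^ 2 := by
      have hX := E₄_sub_one_isBigO
      have hX1 : (fun τ : ℍ => E₄ τ - 1) =O[atImInfty] fun _ : ℍ => (1 : ℝ) := hX.trans expDecay_isBigO_one'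
      have hb : (fun τ : ℍ => (E₄ τ - 1) * (E₄ τ - 1) + 3 * (E₄ τ - 1) + 3) =O[atImInfty] fun _ : ℍ => (1 : ℝ) := by
        have h11 : (fun τ : ℍ => (E₄ τ - 1) * (E₄ τ - 1)) =O[atImInfty] fun _ : ℍ => (1 : ℝ) := by
          simpa using hX1.mul hX1
        exact (h11.add (hX1.const_mul_left 3)).add (isBigO_const_const (3 : ℂ) one_ne_zero atImInfty)
      have h3 : (fun τ : ℍ => E₄ τ ^ 3 - 1) =O[atImInfty] expDecay := by
        have := hX.mul hb
        refine (this.congr_left fun τ => by ring).congr_right fun τ => by simp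
      simpa [sq] using qfun_isBigO.mul h3
    have h3 : (fun τ => kleinJ z * (qfun τ * ModularForm.discriminant τ)) =O[atImInfty] fun τ => expDecay τ ^ 2 := by
      simpa [sq] using (qfun_isBigO.mul discriminant_isBigO).const_mul_left (kleinJ z)
    exact (h1.sub h2).add h3
  refine IsBigO.trans (IsBigO.of_bound 2 ?_) hnum
  filter_upwards [hev, eventually_kleinJ_ne z] with τ hτ hJ
  have hne : E₄ τ ^ 3 - kleinJ z * ModularForm.discriminant τ ≠ 0 := fun h0 => by
    rw [h0, norm_zero] at hτ; norm_num at hτ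
  have hΔ := ModularForm.discriminant_ne_zero τ
  have hj : kleinJ τ = E₄ τ ^ 3 / ModularForm.discriminant τ := by
    rw [eq_div_iff hΔ]; exact (E₄_cube_eq_kleinJ_mul τ).symm
  have hform : (kleinJ τ - kleinJ z)⁻¹ - qfun τ =
      ((ModularForm.discriminant τ - qfun τ) - qfun τ * (E₄ τ ^ 3 - 1) +
        kleinJ z * (qfun τ * ModularForm.discriminant τ)) / (E₄ τ ^ 3 - kleinJ z * ModularForm.discriminant τ) := by
    have hne' : E₄ τ ^ 3 - ModularForm.discriminant τ * kleinJ z ≠ 0 := by rwa [mul_comm] at hne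
    rw [hj]
    field_simp
    ring
  rw [hform, norm_div, div_le_iff₀ (by linarith)]
  nlinarith [norm_nonneg ((ModularForm.discriminant τ - qfun τ) - qfun τ * (E₄ τ ^ 3 - 1) +
    kleinJ z * (qfun τ * ModularForm.discriminant τ))]

/-- **`φ₋₂ − 2φ₀ + φ₂ − (144i/π)q = O(|τ|q²)`** (`= τ(1−E₂)² − (6i/π)(E₂ − 1 + 24q)`).
[cite: CohnEtAl2019, §4.4 (4.14)] -/
theorem phi_alt_sum_second_order :
    (fun τ => phiNeg2 τ - 2 * phi0 τ + phi2 τ - 144 * I / π * qfun τ) =O[atImInfty]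
      fun τ : ℍ => ‖(τ : ℂ)‖ * expDecay τ ^ 2 := by
  have hE := E2_sub_one_isBigO
  have hE2 := E2_second_order
  have hcoe : (fun τ : ℍ => (τ : ℂ)) =O[atImInfty] fun τ : ℍ => ‖(τ : ℂ)‖ :=
    IsBigO.of_bound 1 (Eventually.of_forall fun τ => by simp)
  have h1 : (fun τ : ℍ => (τ : ℂ) * ((E2 τ - 1) * (E2 τ - 1))) =O[atImInfty] fun τ : ℍ => ‖(τ : ℂ)‖ * expDecay τ ^ 2 := by
    have := hcoe.mul (hE.mul hE)
    exact this.congr_right fun τ => by ring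
  have h2 : (fun τ : ℍ => (6 * I / π : ℂ) * (E2 τ - 1 + 24 * qfun τ)) =O[atImInfty] fun τ : ℍ => ‖(τ : ℂ)‖ * expDecay τ ^ 2 := by
    refine (hE2.const_mul_left _).trans (IsBigO.of_bound 1 ?_)
    filter_upwards [eventually_one_le_norm_coe] with τ hτ
    rw [Real.norm_of_nonneg (sq_nonneg _), Real.norm_of_nonneg (mul_nonneg (norm_nonneg _) (sq_nonneg _)), one_mul]
    nlinarith [sq_nonneg (expDecay τ)]
  exact (h1.sub h2).congr_left fun τ => by simp only [phiNeg2, phi0, phi2]; ring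

/-- **`φ₂ − φ₋₂ + 6i/π = τ(E₂ − 1)(E₂ + 1) − (6i/π)(E₂ − 1) = O(|τ|q)`.** [cite: CohnEtAl2019, §4.4 (4.14)] -/
theorem phi2_sub_phiNeg2_isBigO :
    (fun τ => phi2 τ - phiNeg2 τ + 6 * I / π) =O[atImInfty] fun τ : ℍ => ‖(τ : ℂ)‖ * expDecay τ := by
  have hE := E2_sub_one_isBigO
  have hb : (fun τ => E2 τ + 1) =O[atImInfty] fun _ : ℍ => (1 : ℝ) := by
    have h : IsBoundedAtImInfty (fun τ => E2 τ + 1) :=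
      EisensteinSeries.isBoundedAtImInfty_E2.add (Filter.const_boundedAtFilter _ _)
    exact h
  have hcoe : (fun τ : ℍ => (τ : ℂ)) =O[atImInfty] fun τ : ℍ => ‖(τ : ℂ)‖ :=
    IsBigO.of_bound 1 (Eventually.of_forall fun τ => by simp)
  have h1 : (fun τ : ℍ => (τ : ℂ) * ((E2 τ - 1) * (E2 τ + 1))) =O[atImInfty] fun τ : ℍ => ‖(τ : ℂ)‖ * expDecay τ := by
    have := hcoe.mul (hE.mul hb)
    exact this.congr_right fun τ => by simp
  have h2 : (fun τ : ℍ => (6 * I / π : ℂ) * (E2 τ - 1)) =O[atImInfty] fun τ : ℍ => ‖(τ : ℂ)‖ * expDecay τ := by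
    refine (hE.const_mul_left _).trans (IsBigO.of_bound 1 ?_)
    filter_upwards [eventually_one_le_norm_coe] with τ hτ
    rw [Real.norm_of_nonneg (expDecay_pos τ).le, Real.norm_of_nonneg (mul_nonneg (norm_nonneg _) (expDecay_pos τ).le),
      one_mul]
    nlinarith [expDecay_pos τ]
  exact (h1.sub h2).congr_left fun τ => by simp only [phiNeg2, phi2]; ring

/-! ## The bound -/

/-- `O(|τ|)·O(q²) = O(|τ|q²)` — the type-specialised instance of Mathlib's `Asymptotics.IsBigO.mul`
(dedup item dedup-01225: the proofs below now call `IsBigO.mul` directly; this name is kept as a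
deprecated pointer). [folklore] -/
@[deprecated Asymptotics.IsBigO.mul (since := "2026-08-16")]
theorem isBigO_norm_mul_sq {f g : ℍ → ℂ} (hf : f =O[atImInfty] fun τ : ℍ => ‖(τ : ℂ)‖)
    (hg : g =O[atImInfty] fun τ => expDecay τ ^ 2) :
    (fun τ => f τ * g τ) =O[atImInfty] fun τ : ℍ => ‖(τ : ℂ)‖ * expDecay τ ^ 2 := hf.mul hg

/-- **(4.14) for `𝒦₊^{(24)}`**: for fixed `z`, `𝒦₊^{(24)}(τ, z) = O(|τ| e^{−4π Im τ})` as `Im τ → ∞`.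
[cite: CohnEtAl2019, §4.4 (4.14)] -/
theorem kernelPlus24_isBigO (z : ℍ) :
    (fun τ => kernelPlus24 τ z) =O[atImInfty] fun τ : ℍ => ‖(τ : ℂ)‖ * expDecay τ ^ 2 := by
  obtain ⟨h14, h43, h10⟩ := E14_E4cube_E10_second_order
  have hJq := inv_kleinJ_sub_sub_q_isBigO z
  have hJ := inv_kleinJ_sub_isBigO z
  have hΔq := discriminant_second_order
  have hΔ := discriminant_isBigO
  have halt := phi_alt_sum_second_order
  have hdiff := phi2_sub_phiNeg2_isBigO
  have hq := qfun_isBigO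
  have hq1 := qfun_isBigO_one
  have hφm := phiNeg2_isBigO
  have hφ0 := phi0_isBigO
  have hφ2 := phi2_isBigO
  have hE10b : E10fun =O[atImInfty] fun _ : ℍ => (1 : ℝ) := by
    have h : E10fun =O[atImInfty] fun _ : ℍ => (1 : ℝ) :=
      (ModularFormClass.bdd_at_infty E₄).mul (ModularFormClass.bdd_at_infty E₆) |>.congr_left fun τ => rfl
    exact h
  have hE14b : E14fun =O[atImInfty] fun _ : ℍ => (1 : ℝ) := by
    have h : E14fun =O[atImInfty] fun _ : ℍ => (1 : ℝ) :=
      ((ModularFormClass.bdd_at_infty E₄).mul (ModularFormClass.bdd_at_infty E₄)).mul (ModularFormClass.bdd_at_infty E₆)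
        |>.congr_left fun τ => rfl
    exact h
  have hsq1 : (fun τ => expDecay τ ^ 2) =O[atImInfty] fun τ => expDecay τ :=
    IsBigO.of_bound 1 (Eventually.of_forall fun τ => by
      rw [Real.norm_of_nonneg (sq_nonneg _), Real.norm_of_nonneg (expDecay_pos τ).le, one_mul, sq]
      exact mul_le_of_le_one_left (expDecay_pos τ).le (expDecay_le_one τ))
  have hE10q : (fun τ => E10fun τ - 1) =O[atImInfty] fun τ => expDecay τ := by
    have h' : (fun τ => E10fun τ - 1 + 264 * qfun τ) =O[atImInfty] fun τ => expDecay τ := h10.trans hsq1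
    have h'' : (fun τ => 264 * qfun τ) =O[atImInfty] fun τ => expDecay τ := hq.const_mul_left 264
    exact (h'.sub h'').congr_left fun τ => by ring
  have hE14q : (fun τ => E14fun τ - 1) =O[atImInfty] fun τ => expDecay τ := by
    have h' : (fun τ => E14fun τ - 1 + 24 * qfun τ) =O[atImInfty] fun τ => expDecay τ := h14.trans hsq1
    have h'' : (fun τ => 24 * qfun τ) =O[atImInfty] fun τ => expDecay τ := hq.const_mul_left 24
    exact (h'.sub h'').congr_left fun τ => by ring
  -- target class abbreviation
  -- 𝒜
  have hA : (fun τ => 6 * phiNeg2 τ * E14fun τ - 12 * phi0 τ * E₄ τ ^ 3 + 5 * 1728 * phi0 τ * ModularForm.discriminant τ +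
      6 * phi2 τ * E10fun τ + 1728 * phi2 τ * E10fun τ * (kleinJ τ - kleinJ z)⁻¹) =O[atImInfty]
      fun τ : ℍ => ‖(τ : ℂ)‖ * expDecay τ ^ 2 := by
    have g1 := ((hφm.mul h14).const_mul_left 6)
    have g2 := ((hφ0.mul h43).const_mul_left 12)
    have g3 := ((hφ2.mul h10).const_mul_left 6)
    have g4 := halt.const_mul_left 6
    have g5 := (hφ0.mul hΔq).const_mul_left (5 * 1728)
    have g6 : (fun τ => phi2 τ * (E10fun τ * ((kleinJ τ - kleinJ z)⁻¹ - qfun τ))) =O[atImInfty]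
        fun τ : ℍ => ‖(τ : ℂ)‖ * expDecay τ ^ 2 := by
      have := hE10b.mul hJq
      exact hφ2.mul (by simpa using this)
    have g6' := g6.const_mul_left 1728
    have g7 : (fun τ => qfun τ * (phi2 τ * (E10fun τ - 1))) =O[atImInfty] fun τ : ℍ => ‖(τ : ℂ)‖ * expDecay τ ^ 2 := by
      have := hq.mul (hφ2.mul hE10q)
      exact this.congr_right fun τ => by ring
    have g7' := g7.const_mul_left 1728
    have g8 : (fun τ => qfun τ * (phi2 τ - phiNeg2 τ + 6 * I / π)) =O[atImInfty] fun τ : ℍ => ‖(τ : ℂ)‖ * expDecay τ ^ 2 := by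
      have := hq.mul hdiff
      exact this.congr_right fun τ => by ring
    have g8' := g8.const_mul_left 144
    have total := ((((((g1.sub g2).add g3).add g4).add g5).add g6').add g7').add g8'
    refine total.congr_left fun τ => ?_
    ring
  -- 𝓑
  have hB : (fun τ => -6 * phiNeg2 τ * E14fun τ + 12 * phi0 τ * E₄ τ ^ 3 - 7 * 1728 * phi0 τ * ModularForm.discriminant τ -
      6 * phi2 τ * E10fun τ + 1728 * phiNeg2 τ * E14fun τ * (kleinJ τ - kleinJ z)⁻¹) =O[atImInfty]
      fun τ : ℍ => ‖(τ : ℂ)‖ * expDecay τ ^ 2 := by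
    have g1 := ((hφm.mul h14).const_mul_left 6)
    have g2 := ((hφ0.mul h43).const_mul_left 12)
    have g3 := ((hφ2.mul h10).const_mul_left 6)
    have g4 := halt.const_mul_left 6
    have g5 := (hφ0.mul hΔq).const_mul_left (7 * 1728)
    have g6 : (fun τ => phiNeg2 τ * (E14fun τ * ((kleinJ τ - kleinJ z)⁻¹ - qfun τ))) =O[atImInfty]
        fun τ : ℍ => ‖(τ : ℂ)‖ * expDecay τ ^ 2 := by
      have := hE14b.mul hJq
      exact hφm.mul (by simpa using this)
    have g6' := g6.const_mul_left 1728
    have g7 : (fun τ => qfun τ * (phiNeg2 τ * (E14fun τ - 1))) =O[atImInfty] fun τ : ℍ => ‖(τ : ℂ)‖ * expDecay τ ^ 2 := by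
      have := hq.mul (hφm.mul hE14q)
      exact this.congr_right fun τ => by ring
    have g7' := g7.const_mul_left 1728
    have g8 : (fun τ => qfun τ * (phi2 τ - phiNeg2 τ + 6 * I / π)) =O[atImInfty] fun τ : ℍ => ‖(τ : ℂ)‖ * expDecay τ ^ 2 := by
      have := hq.mul hdiff
      exact this.congr_right fun τ => by ring
    have g8' := g8.const_mul_left 144
    -- `q · alt = O(|τ| q²)` as well (`alt = O(|τ|q)`)
    have g9 : (fun τ => qfun τ * (phiNeg2 τ - 2 * phi0 τ + phi2 τ)) =O[atImInfty] fun τ : ℍ => ‖(τ : ℂ)‖ * expDecay τ ^ 2 := by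
      have := hq.mul phi_alt_sum_isBigO
      exact this.congr_right fun τ => by ring
    have g9' := g9.const_mul_left 1728
    have total := (((((((g1.sub g2).add g3).add g4).neg_left.sub g5).add g6').add g7').add g9').sub g8'
    refine total.congr_left fun τ => ?_
    ring
  -- 𝒟
  have hD : (fun τ => phi0 τ * ModularForm.discriminant τ * (kleinJ τ - kleinJ z)⁻¹) =O[atImInfty]
      fun τ : ℍ => ‖(τ : ℂ)‖ * expDecay τ ^ 2 := by
    have := hφ0.mul (hΔ.mul hJ)
    refine (this.congr_left fun τ => by ring).congr_right fun τ => by ring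
  -- assemble: `𝒦 = (c/Δz)·(a𝒜 + b𝓑 − 2𝔠d𝒟)`
  set c : ℂ := (π : ℂ) ^ 2 / (36 * 1728 * I) with hc
  have total := (((hA.const_mul_left (E₄ z * phiTildeNeg2 z)).add (hB.const_mul_left (phiTilde2 z))).sub
    (hD.const_mul_left (2 * 1728 * (f2fun z * phiTilde0 z)))).const_mul_left (c / ModularForm.discriminant z)
  refine total.congr' ?_ EventuallyEq.rfl
  filter_upwards [eventually_kleinJ_ne z] with τ hJne
  have hΔz := ModularForm.discriminant_ne_zero z
  have hΔτ := ModularForm.discriminant_ne_zero τ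
  have hjΔ : kleinJ τ * ModularForm.discriminant τ = E₄ τ ^ 3 := (E₄_cube_eq_kleinJ_mul τ).symm
  simp only [kernelPlus24, hc]
  field_simp
  -- replace `E₄ τ ^ 3` by `kleinJ τ * Δ τ`
  rw [← hjΔ]
  ring

end Literature.NumberTheory.ModularForms
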